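import Summits.RiemannHypothesis.RiemannHypothesis.Theorems.SpectralTraceHeckeSurrogateDefs
import Summits.RiemannHypothesis.RiemannHypothesis.Theorems.SpectralTraceWindowTracePrime2StubXi2Surrogate
import Literature.NumberTheory.ModularForms.WeightHalfThetaMellin
import HarnessLib

/-!
# Hecke's correspondence `(B) ⇒ (A)` for real cusp data of level 9 — stub `stub_heckeTransfer`

Route `RiemannHypothesis/SpectralTrace`, crux `WindowTracePrime2` (stmt-RiemannHypothesis-11196),
line `hecke-cusp-perturbation-surrogate`, registered stub **H**
`stub_heckeTransfer : IsSurrogate xi2 → ∀ a q, IsCuspDatum a q → IsSurrogate (surrogate a q)`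
(skeleton `Cruxes/WindowTracePrime2/Lines/hecke_cusp_perturbation_surrogate.lean`; vocabulary
`Theorems/SpectralTraceHeckeSurrogateDefs.lean`).

For a real cusp datum `(a, q)` of level `9` (`q_n ≥ 9`, `Σ |a_n| q_n^{-σ₀} < ∞`,
`φ(1/y) = √y φ(y)` for the theta series `φ = cuspTheta a q`), the designed object
`E_φ(s) = ξ₂(s) + s(s-1)·(Mellin φ)(s/2)` is a window-invisible self-dual degree-one surrogate:

* ENTIRE and `E_φ(1-s) = E_φ(s)`: Mathlib's strong FE-pair with `f = g = φ`, `k = 1/2`, `ε = 1`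
  gives `Mellin φ` entire with `(Mellin φ)(1/2 - w) = (Mellin φ)(w)` (generic file
  `Literature/NumberTheory/ModularForms/WeightHalfThetaMellin.lean`, `mellin_theta_props`);
* ORDER `≤ 1` in Titchmarsh's quantitative form: `‖(Mellin φ)(w)‖ ≤ C + C e^{‖w‖ log(1+‖w‖)}` on
  `Re w ≥ 1/4` (`norm_mellin_theta_le`), combined with the bound for `ξ₂` on `Re s ≥ 1/2` and
  symmetrised by `E_φ(1-s) = E_φ(s)` (`norm_add_mul_le_of_half_le_re`, `order_bound_of_symm`,
  proved here with Mathlib notions only);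
* DIRICHLET DATA: on `Re s ≫ 1`, `s(s-1)(Mellin φ)(s/2) = s(s-1)Γ_ℝ(s) Σ_n a_n (√q_n)^{-s}`
  (`mellin_theta_half_eq_tsum`, Mathlib `hasSum_mellin_pi_mul_sq`), interleaved behind the two
  leading terms `1 + 2^{-s}` of the data of `ξ₂` (`hasSum_interleave`); the new frequencies are
  `√q_n ≥ 3` — WINDOW-INVISIBILITY.

References: E. Hecke, *Über die Bestimmung Dirichletscher Reihen durch ihre Funktionalgleichung*,
Math. Ann. 112 (1936), §2 [Hecke1936]; B. C. Berndt, M. I. Knopp, *Hecke's theory of modular forms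
and Dirichlet series* (2008), Thm 2.1 [BerndtKnopp2008].
-/

noncomputable section

set_option linter.dupNamespace false

namespace Summit.RiemannHypothesis.RiemannHypothesis.Theorems.HeckeSurrogate

open Complex Filter Set MeasureTheory
open scoped Real Topology
open Literature.NumberTheory.LFunctions
open Literature.Uncategorized
open Literature.NumberTheory.ModularForms.WeightHalfTheta

/-! ## Two growth bookkeeping lemmas (only Mathlib notions) -/

/-- Growth of `E₁(s) + s(s-1)·M(s/2)` on `Re s ≥ 1/2` from an order-`1` bound on `E₁` and the
half-plane bound on `M`: `≤ (C₁ + 2Ce⁴) exp((A₁+3)‖s‖ log(1+‖s‖))`. [folklore] -/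
theorem norm_add_mul_le_of_half_le_re {E₁ M : ℂ → ℂ} {A₁ C₁ C : ℝ} (hC₁ : 0 ≤ C₁)
    (hA₁ : 0 ≤ A₁) (hC : 0 ≤ C)
    (h₁ : ∀ s : ℂ, ‖E₁ s‖ ≤ C₁ * Real.exp (A₁ * ‖s‖ * Real.log (1 + ‖s‖)))
    (hM : ∀ w : ℂ, 1 / 4 ≤ w.re → ‖M w‖ ≤ C + C * Real.exp (‖w‖ * Real.log (1 + ‖w‖)))
    {s : ℂ} (hσ : 1 / 2 ≤ s.re) :
    ‖E₁ s + s * (s - 1) * M (s / 2)‖ ≤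
      (C₁ + 2 * C * Real.exp 4) * Real.exp ((A₁ + 3) * ‖s‖ * Real.log (1 + ‖s‖)) := by
  set N : ℝ := ‖s‖ with hNdef
  have hN : 0 ≤ N := norm_nonneg _
  set L : ℝ := Real.log (1 + N) with hLdef
  have hL : 0 ≤ L := Real.log_nonneg (by linarith)
  have hNL : 0 ≤ N * L := mul_nonneg hN hL
  have hw : 1 / 4 ≤ (s / 2).re := by
    rw [Complex.div_ofNat_re]
    linarith
  have hn2 : ‖s / 2‖ = N / 2 := by rw [norm_div, Complex.norm_two]
  have hMw : ‖M (s / 2)‖ ≤ C + C * Real.exp (N * L) := by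
    refine (hM (s / 2) hw).trans ?_
    rw [hn2]
    gcongr C + C * Real.exp ?_
    exact mul_le_mul (by linarith) (Real.log_le_log (by linarith) (by linarith))
      (Real.log_nonneg (by linarith)) hN
  have hss : ‖s * (s - 1)‖ ≤ Real.exp 4 * Real.exp (2 * (N * L)) := by
    rw [norm_mul]
    have h1 : ‖s - 1‖ ≤ N + 1 := (norm_sub_le _ _).trans (by simp [hNdef])
    have h3 : 1 + N ≤ Real.exp N := by linarith [Real.add_one_le_exp N]
    have h4 : (1 + N) ^ 2 ≤ Real.exp N ^ 2 := pow_le_pow_left₀ (by positivity) h3 2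
    have h5 : Real.exp N ^ 2 = Real.exp (2 * N) := by rw [← Real.exp_nat_mul]; norm_num
    have h6 : 2 * N ≤ 4 + 2 * (N * L) := by
      linarith [Literature.NumberTheory.LFunctions.le_two_add_mul_log hN]
    calc ‖s‖ * ‖s - 1‖ ≤ N * (N + 1) := by gcongr
      _ ≤ (1 + N) ^ 2 := by nlinarith
      _ ≤ Real.exp (2 * N) := by rw [← h5]; exact h4
      _ ≤ Real.exp (4 + 2 * (N * L)) := Real.exp_le_exp.2 h6
      _ = Real.exp 4 * Real.exp (2 * (N * L)) := Real.exp_add _ _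
  set X : ℝ := Real.exp ((A₁ + 3) * N * L) with hXdef
  have hX1 : Real.exp (A₁ * N * L) ≤ X := Real.exp_le_exp.2 (by nlinarith)
  have hX2 : Real.exp (2 * (N * L)) ≤ X := Real.exp_le_exp.2 (by nlinarith)
  have hX3 : Real.exp (2 * (N * L)) * Real.exp (N * L) ≤ X := by
    rw [← Real.exp_add]
    exact Real.exp_le_exp.2 (by nlinarith)
  calc ‖E₁ s + s * (s - 1) * M (s / 2)‖ ≤ ‖E₁ s‖ + ‖s * (s - 1)‖ * ‖M (s / 2)‖ := by
        refine (norm_add_le _ _).trans ?_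
        rw [norm_mul (s * (s - 1))]
    _ ≤ C₁ * Real.exp (A₁ * N * L) + Real.exp 4 * Real.exp (2 * (N * L)) * (C + C * Real.exp (N * L)) := by
        gcongr
        exact h₁ s
    _ = C₁ * Real.exp (A₁ * N * L) + C * Real.exp 4 * Real.exp (2 * (N * L)) +
          C * Real.exp 4 * (Real.exp (2 * (N * L)) * Real.exp (N * L)) := by ring
    _ ≤ C₁ * X + C * Real.exp 4 * X + C * Real.exp 4 * X := by
        gcongr
    _ = (C₁ + 2 * C * Real.exp 4) * X := by ring

/-- **Symmetrisation of an order bound**: if `E(1-s) = E(s)` and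
`‖E(s)‖ ≤ C exp(A‖s‖ log(1+‖s‖))` on `Re s ≥ 1/2` (`A ≥ 0`), then
`‖E(s)‖ ≤ C e^{5A} exp(3A‖s‖ log(1+‖s‖))` everywhere (`‖1-s‖ ≤ 1 + ‖s‖`). [folklore] -/
theorem order_bound_of_symm {E : ℂ → ℂ} (hsymm : ∀ s : ℂ, E (1 - s) = E s) {A C : ℝ}
    (hA : 0 ≤ A)
    (h : ∀ s : ℂ, 1 / 2 ≤ s.re → ‖E s‖ ≤ C * Real.exp (A * ‖s‖ * Real.log (1 + ‖s‖))) :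
    ∀ s : ℂ, ‖E s‖ ≤ C * Real.exp (5 * A) * Real.exp (3 * A * ‖s‖ * Real.log (1 + ‖s‖)) := by
  have hC : 0 ≤ C := by
    have h1 := h 1 (by norm_num)
    have hpos := Real.exp_pos (A * ‖(1 : ℂ)‖ * Real.log (1 + ‖(1 : ℂ)‖))
    refine le_of_mul_le_mul_right ?_ hpos
    rw [zero_mul]
    exact (norm_nonneg _).trans h1
  intro s
  set N : ℝ := ‖s‖ with hNdef
  have hN : 0 ≤ N := norm_nonneg _
  set L : ℝ := Real.log (1 + N) with hLdef
  have hL : 0 ≤ L := Real.log_nonneg (by linarith)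
  have hNL : 0 ≤ N * L := mul_nonneg hN hL
  rcases le_or_gt (1 / 2 : ℝ) s.re with hσ | hσ
  · calc ‖E s‖ ≤ C * Real.exp (A * N * L) := h s hσ
      _ ≤ C * Real.exp (5 * A + 3 * A * N * L) := by
          gcongr
          nlinarith
      _ = C * Real.exp (5 * A) * Real.exp (3 * A * N * L) := by rw [Real.exp_add]; ring
  · have hσ' : 1 / 2 ≤ (1 - s).re := by
      simp only [sub_re, one_re]
      linarith
    have h' := h (1 - s) hσ'
    rw [hsymm] at h'
    set N' : ℝ := ‖1 - s‖ with hN'def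
    have hN'0 : 0 ≤ N' := norm_nonneg _
    have hN' : N' ≤ 1 + N := by
      calc ‖1 - s‖ ≤ ‖(1 : ℂ)‖ + ‖s‖ := norm_sub_le _ _
        _ = 1 + N := by simp [hNdef]
    have hlog2 : Real.log (1 + N') ≤ 1 + L := by
      calc Real.log (1 + N') ≤ Real.log (2 * (1 + N)) :=
            Real.log_le_log (by linarith) (by linarith)
        _ = Real.log 2 + L := by rw [Real.log_mul (by norm_num) (by linarith)]
        _ ≤ 1 + L := by linarith [Real.log_two_lt_d9]
    have hkey : N' * Real.log (1 + N') ≤ 5 + 3 * (N * L) := by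
      have h1 : N' * Real.log (1 + N') ≤ (1 + N) * (1 + L) :=
        mul_le_mul hN' hlog2 (Real.log_nonneg (by linarith)) (by linarith)
      have h2 : L ≤ N := Literature.NumberTheory.LFunctions.log_one_add_le_self hN
      have h3 : N ≤ 2 + N * L := Literature.NumberTheory.LFunctions.le_two_add_mul_log hN
      nlinarith
    have hAkey : A * N' * Real.log (1 + N') ≤ 5 * A + 3 * A * N * L := by
      have := mul_le_mul_of_nonneg_left hkey hA
      calc A * N' * Real.log (1 + N') = A * (N' * Real.log (1 + N')) := by ring
        _ ≤ A * (5 + 3 * (N * L)) := this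
        _ = 5 * A + 3 * A * N * L := by ring
    calc ‖E s‖ ≤ C * Real.exp (A * N' * Real.log (1 + N')) := h'
      _ ≤ C * Real.exp (5 * A + 3 * A * N * L) := by gcongr
      _ = C * Real.exp (5 * A) * Real.exp (3 * A * N * L) := by rw [Real.exp_add]; ring

/-! ## A cusp datum in the generic vocabulary -/

/-- The hypotheses of the generic theta-series file extracted from a real cusp datum of level 9:
`q_n ≥ 1`, `Σ ‖a_n‖ q_n^{-σ₀} < ∞` with complexified coefficients, and the (definitional)
identification of `cuspTheta a q` with the generic theta series. [folklore] -/
theorem cuspDatum_generic {a : ℕ → ℝ} {q : ℕ → ℝ} (h : IsCuspDatum a q) :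
    (∀ n, 1 ≤ q n) ∧ (∃ σ₀ : ℝ, Summable fun n => ‖((a n : ℝ) : ℂ)‖ * q n ^ (-σ₀)) ∧
      ∀ y : ℝ, 0 < y →
        cuspTheta a q y = ∑' n, ((a n : ℝ) : ℂ) * (Real.exp (-π * q n * y) : ℂ) := by
  obtain ⟨hq9, ⟨σ₀, hs⟩, -⟩ := h
  refine ⟨fun n => by linarith [hq9 n], ⟨σ₀, ?_⟩, fun y _ => rfl⟩
  simpa only [Complex.norm_real, Real.norm_eq_abs] using hs

/-! ## The four conjuncts of `IsSurrogate (surrogate a q)` -/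

/-- `E_φ` is entire (`ξ₂` is, and `Mellin φ` is by the strong FE-pair).
[cite: BerndtKnopp2008, Thm 2.1] -/
theorem differentiable_surrogate {a : ℕ → ℝ} {q : ℕ → ℝ} (h : IsCuspDatum a q) :
    Differentiable ℂ (surrogate a q) := by
  obtain ⟨hq1, ⟨σ₀, hs⟩, hφ⟩ := cuspDatum_generic h
  have hM : Differentiable ℂ (mellin (cuspTheta a q)) := (mellin_theta_props hq1 hs hφ h.2.2).1
  show Differentiable ℂ fun s => xi2 s + s * (s - 1) * mellin (cuspTheta a q) (s / 2)
  exact differentiable_xi2.add ((differentiable_id.mul (differentiable_id.sub_const 1)).mul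
    (hM.comp (differentiable_id.div_const 2)))

/-- The functional equation `E_φ(1-s) = E_φ(s)` (`ξ₂(1-s) = ξ₂(s)` and
`(Mellin φ)(1/2 - w) = (Mellin φ)(w)`). [cite: BerndtKnopp2008, Thm 2.1] -/
theorem surrogate_one_sub {a : ℕ → ℝ} {q : ℕ → ℝ} (h : IsCuspDatum a q) (s : ℂ) :
    surrogate a q (1 - s) = surrogate a q s := by
  obtain ⟨hq1, ⟨σ₀, hs⟩, hφ⟩ := cuspDatum_generic h
  have hFE := (mellin_theta_props hq1 hs hφ h.2.2).2.1
  show xi2 (1 - s) + (1 - s) * (1 - s - 1) * mellin (cuspTheta a q) ((1 - s) / 2) =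
    xi2 s + s * (s - 1) * mellin (cuspTheta a q) (s / 2)
  rw [xi2_one_sub, show (1 - s) / 2 = 1 / 2 - s / 2 by ring, hFE (s / 2)]
  ring

/-- `E_φ` has order at most `1` in Titchmarsh's quantitative form
`‖E_φ(s)‖ ≤ C exp(A‖s‖ log(1+‖s‖))`. [folklore] -/
theorem surrogate_order (hxi : IsSurrogate xi2) {a : ℕ → ℝ} {q : ℕ → ℝ} (h : IsCuspDatum a q) :
    ∃ A C : ℝ, ∀ s : ℂ, ‖surrogate a q s‖ ≤ C * Real.exp (A * ‖s‖ * Real.log (1 + ‖s‖)) := by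
  obtain ⟨A₁, C₁, h₁⟩ := hxi.2.1
  obtain ⟨hq1, ⟨σ₀, hs⟩, hφ⟩ := cuspDatum_generic h
  obtain ⟨C, hC0, hM⟩ := norm_mellin_theta_le hq1 hs hφ h.2.2
  have hC₁ : 0 ≤ C₁ := by
    have := h₁ 0
    simp only [norm_zero, mul_zero, zero_mul, Real.exp_zero, mul_one] at this
    exact (norm_nonneg _).trans this
  have h₁' : ∀ s : ℂ, ‖xi2 s‖ ≤ C₁ * Real.exp (max A₁ 0 * ‖s‖ * Real.log (1 + ‖s‖)) := fun s => by
    refine (h₁ s).trans (mul_le_mul_of_nonneg_left (Real.exp_le_exp.2 ?_) hC₁)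
    have h0 : 0 ≤ ‖s‖ * Real.log (1 + ‖s‖) :=
      mul_nonneg (norm_nonneg _) (Real.log_nonneg (by linarith [norm_nonneg s]))
    nlinarith [mul_nonneg (sub_nonneg.2 (le_max_left A₁ 0)) h0]
  have hhalf : ∀ s : ℂ, 1 / 2 ≤ s.re → ‖surrogate a q s‖ ≤ (C₁ + 2 * C * Real.exp 4) *
      Real.exp ((max A₁ 0 + 3) * ‖s‖ * Real.log (1 + ‖s‖)) := fun s hσ =>
    norm_add_mul_le_of_half_le_re hC₁ (le_max_right _ _) hC0 h₁' hM hσ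
  exact ⟨_, _, order_bound_of_symm (surrogate_one_sub h) (by positivity) hhalf⟩

/-- **The Dirichlet data of `E_φ`**: on `Re s > σ''`,
`E_φ(s) = s(s-1)Γ_ℝ(s) Σ_k c''_k ν''_k^{-s}` with `c''_0 = c''_1 = 1`, `ν''_0 = 1`, `ν''_1 = 2` (from
`ξ₂`) and all further frequencies `≥ 3`: those of `ξ₂` interleaved with the `√q_n ≥ 3` carrying the
coefficients `a_n` (termwise Mellin transform `∫₀^∞ e^{-π q t} t^{s/2-1} dt = (πq)^{-s/2}Γ(s/2)`).
[cite: Hecke1936, §2] -/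
theorem surrogate_dirichlet (hxi : IsSurrogate xi2) {a : ℕ → ℝ} {q : ℕ → ℝ}
    (h : IsCuspDatum a q) :
    ∃ (c : ℕ → ℂ) (ν : ℕ → ℝ) (σ₀ : ℝ),
      c 0 = 1 ∧ ν 0 = 1 ∧ c 1 = 1 ∧ ν 1 = 2 ∧ (∀ k : ℕ, 2 ≤ k → 3 ≤ ν k) ∧
      Summable (fun k => ‖c k‖ * ν k ^ (-σ₀)) ∧
      ∀ s : ℂ, σ₀ < s.re →
        surrogate a q s = s * (s - 1) * s.Gammaℝ * ∑' k, c k * ((ν k : ℂ) ^ (-s)) := by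
  obtain ⟨c', ν', σ₁, hc0, hν0, hc1, hν1, hν3, hsum', hexp'⟩ := hxi.2.2.2
  obtain ⟨hq1, ⟨σa, hsa⟩, hφ⟩ := cuspDatum_generic h
  have hq9 := h.1
  have hν'1 : ∀ k, 1 ≤ ν' k := fun k => by
    rcases Nat.lt_or_ge k 2 with hk | hk
    · interval_cases k
      · rw [hν0]
      · rw [hν1]; norm_num
    · linarith [hν3 k hk]
  obtain ⟨c'', hc''0, hc''1, hc''e, hc''o⟩ : ∃ c'' : ℕ → ℂ, c'' 0 = c' 0 ∧ c'' 1 = c' 1 ∧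
      (∀ k, c'' (2 * k + 2) = c' (k + 2)) ∧ ∀ k, c'' (2 * k + 3) = (a k : ℂ) :=
    ⟨fun n => if n < 2 then c' n else if n % 2 = 0 then c' (n / 2 + 1) else (a ((n - 3) / 2) : ℂ),
      by simp, by simp, fun k => by
        beta_reduce
        rw [if_neg (by omega), if_pos (by omega), show (2 * k + 2) / 2 + 1 = k + 2 by omega],
      fun k => by
        beta_reduce
        rw [if_neg (by omega), if_neg (by omega), show (2 * k + 3 - 3) / 2 = k by omega]⟩
  obtain ⟨ν'', hν''0, hν''1, hν''e, hν''o⟩ : ∃ ν'' : ℕ → ℝ, ν'' 0 = ν' 0 ∧ ν'' 1 = ν' 1 ∧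
      (∀ k, ν'' (2 * k + 2) = ν' (k + 2)) ∧ ∀ k, ν'' (2 * k + 3) = Real.sqrt (q k) :=
    ⟨fun n => if n < 2 then ν' n else if n % 2 = 0 then ν' (n / 2 + 1)
        else Real.sqrt (q ((n - 3) / 2)),
      by simp, by simp, fun k => by
        beta_reduce
        rw [if_neg (by omega), if_pos (by omega), show (2 * k + 2) / 2 + 1 = k + 2 by omega],
      fun k => by
        beta_reduce
        rw [if_neg (by omega), if_neg (by omega), show (2 * k + 3 - 3) / 2 = k by omega]⟩
  have h3sqrt : ∀ k, 3 ≤ Real.sqrt (q k) := fun k => by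
    rw [show (3 : ℝ) = Real.sqrt (3 ^ 2) by rw [Real.sqrt_sq (by norm_num)]]
    exact Real.sqrt_le_sqrt (by linarith [hq9 k])
  set σ'' : ℝ := max σ₁ (2 * max σa 0) with hσ''def
  have hσ''1 : σ₁ ≤ σ'' := le_max_left _ _
  have hσ''2 : 2 * max σa 0 ≤ σ'' := le_max_right _ _
  have hσa : σa ≤ max σa 0 := le_max_left _ _
  have hσ''0 : 0 ≤ σ'' := le_trans (by positivity) hσ''2
  refine ⟨c'', ν'', σ'', by rw [hc''0, hc0], by rw [hν''0, hν0], by rw [hc''1, hc1],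
    by rw [hν''1, hν1], ?_, ?_, ?_⟩
  · refine forall_ge_two_of_even_odd (fun k => ?_) (fun k => ?_)
    · rw [hν''e]
      exact hν3 (k + 2) (by omega)
    · rw [hν''o]
      exact h3sqrt k
  · have hF : Summable fun k => ‖c' k‖ * ν' k ^ (-σ'') := by
      refine hsum'.of_nonneg_of_le
        (fun k => mul_nonneg (norm_nonneg _) (Real.rpow_nonneg (by linarith [hν'1 k]) _))
        fun k => ?_
      exact mul_le_mul_of_nonneg_left
        (Real.rpow_le_rpow_of_exponent_le (hν'1 k) (neg_le_neg hσ''1)) (norm_nonneg _)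
    have hG : Summable fun k => ‖(a k : ℂ)‖ * Real.sqrt (q k) ^ (-σ'') := by
      refine hsa.of_nonneg_of_le
        (fun k => mul_nonneg (norm_nonneg _) (Real.rpow_nonneg (Real.sqrt_nonneg _) _))
        fun k => ?_
      refine mul_le_mul_of_nonneg_left ?_ (norm_nonneg _)
      rw [Real.sqrt_eq_rpow, ← Real.rpow_mul (by linarith [hq1 k])]
      exact Real.rpow_le_rpow_of_exponent_le (hq1 k) (by linarith)
    exact (hasSum_interleave (h := fun k => ‖c'' k‖ * ν'' k ^ (-σ'')) hF.hasSum hG.hasSum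
      (by rw [hc''0, hν''0]) (by rw [hc''1, hν''1]) (fun k => by rw [hc''e, hν''e])
      (fun k => by rw [hc''o, hν''o])).summable
  · intro s hs
    have hσ₁s : σ₁ < s.re := lt_of_le_of_lt hσ''1 hs
    have hs0 : 0 < s.re := lt_of_le_of_lt hσ''0 hs
    have hs2 : 2 * σa ≤ s.re := by linarith
    have hM := mellin_theta_half_eq_tsum hq1 hsa hφ hs0 hs2
    have hF : Summable fun k => c' k * ((ν' k : ℂ) ^ (-s)) := by
      refine hsum'.of_norm_bounded fun k => ?_
      rw [norm_mul, Complex.norm_cpow_eq_rpow_re_of_pos (by linarith [hν'1 k]), neg_re]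
      exact mul_le_mul_of_nonneg_left
        (Real.rpow_le_rpow_of_exponent_le (hν'1 k) (by linarith)) (norm_nonneg _)
    have hG : Summable fun k => (a k : ℂ) * ((Real.sqrt (q k) : ℂ) ^ (-s)) := by
      refine hsa.of_norm_bounded fun k => ?_
      have hqk : 0 < q k := by linarith [hq1 k]
      rw [norm_mul, Complex.norm_cpow_eq_rpow_re_of_pos (Real.sqrt_pos.2 hqk), neg_re,
        Real.sqrt_eq_rpow, ← Real.rpow_mul hqk.le]
      exact mul_le_mul_of_nonneg_left
        (Real.rpow_le_rpow_of_exponent_le (hq1 k) (by linarith)) (norm_nonneg _)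
    have hsum := hasSum_interleave (h := fun k => c'' k * ((ν'' k : ℂ) ^ (-s))) hF.hasSum
      hG.hasSum (by rw [hc''0, hν''0]) (by rw [hc''1, hν''1]) (fun k => by rw [hc''e, hν''e])
      (fun k => by rw [hc''o, hν''o])
    rw [hsum.tsum_eq]
    show xi2 s + s * (s - 1) * mellin (cuspTheta a q) (s / 2) = _
    rw [hexp' s hσ₁s, hM]
    ring

/-! ## The registered stub -/

/-- **`stub_heckeTransfer`** (registered stub H of the line `hecke-cusp-perturbation-surrogate`,
crux stmt-RiemannHypothesis-11196) — Hecke's correspondence `(B) ⇒ (A)`: every real cusp datum of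
level 9 gives a window-invisible self-dual degree-one surrogate
`E_φ = ξ₂ + s(s-1)·(Mellin φ)(s/2)`. [cite: BerndtKnopp2008, Thm 2.1] -/
theorem stub_heckeTransfer :
    IsSurrogate xi2 → ∀ (a : ℕ → ℝ) (q : ℕ → ℝ), IsCuspDatum a q → IsSurrogate (surrogate a q) := by
  intro hxi a q h
  exact ⟨differentiable_surrogate h, surrogate_order hxi h, surrogate_one_sub h,
    surrogate_dirichlet hxi h⟩

end Summit.RiemannHypothesis.RiemannHypothesis.Theorems.HeckeSurrogate

end
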